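import Mathlib
import Literature.RepresentationTheory.FiniteGroups.IsotypicProjector
import Literature.RepresentationTheory.FiniteGroups.CharacterDegrees
import Summits.MatrixMultiplication.MatrixMultiplication.Theorems.LevelGradedCohnUmansLevelOneLinkPermModule

/-!
# Structure of the level-one (frame) space of `GL₂(K)` over a finite field
# (stub `stub_frameStructure` of line `quadratic-extension-level-one-cell`,
# crux `LevelGradedCohnUmans.GradedDesignFamily`, item `stmt-MatrixMultiplication-7610`)

For a finite field `K` (`Q = |K|`) the *frame functions* on `GL₂(K)` are the functions
`g ↦ ∑_{u ∈ K²} c u (g·u)` — sums of functions of ONE matrix–vector product.  We prove: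

* **(i) a spanning set of size `≤ Q³ + Q²`.**  Let `Reps = {(1,0)} ∪ {(t,1) : t ∈ K}` be the
  `≤ Q + 1` line representatives and `B = {g ↦ [g·r = v] : r ∈ Reps, v ∈ K²}`
  (`|B| ≤ (Q+1) Q²`).  Every frame function is `∑_u ∑_v c u v • [g·u = v]`; for `u = 0` the
  indicator `[g·0 = v]` is `0` or the constant `1 = ∑_{v'} [g·r₀ = v']` (`r₀ ∈ Reps`), and for
  `u = t • r` (`r ∈ Reps`, `t ≠ 0`) one has `[g·(t•r) = v] = [g·r = t⁻¹•v] ∈ B`.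
* **(ii) degree bound.**  An irreducible character `χ` of `GL₂(K)` which is a frame function has
  `χ(1) ≤ Q + 1`: by `LevelOneLink.exists_fixed_of_character_eq_sum` its representation has a
  `Stab(a)`-fixed vector for some `a ∈ K²`, and by `LevelOneLink.finrank_le_card_of_cover` its
  degree is at most the size of a set `R ⊆ K²` which, moved by central (scalar) matrices, covers
  the orbit of `a`: `R = {0}` if `a = 0`, `R = Reps` otherwise.

This is the finite-field port (frame form, no additive character) of the `ZMod p` lemmas
`exists_scalar_smul_eq`, `card_lineReps_le`, `exists_cover_card_le`, `exists_degree_le` of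
`Theorems/LevelGradedCohnUmansLevelOneLink.lean`.
-/

-- `Summit.<Summit>.<Problem>` is the tree's mandated summit-side namespace; for this
-- single-conjunct summit the two coincide, so the file silences `dupNamespace`.
set_option linter.dupNamespace false

noncomputable section

open scoped BigOperators
open Module Literature.RepresentationTheory.FiniteGroups

namespace Summit.MatrixMultiplication.MatrixMultiplication.Theorems.GradedDesignFamily

open Matrix
open Summit.MatrixMultiplication.MatrixMultiplication.Theorems.LevelOneLink
  (exists_fixed_of_character_eq_sum finrank_le_card_of_cover)

section GL2

variable (K : Type) [Field K] [Fintype K] [DecidableEq K]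

/-! ### Line representatives and central scalars -/

/-- The line representatives `(1,0)`, `(t,1)` (`t ∈ K`) of `P¹(K)` are at most `|K| + 1` in
number. [folklore] -/
theorem frameStructure_card_reps_le :
    (insert (![1, 0] : Fin 2 → K) (Finset.univ.image fun t : K => ![t, 1])).card ≤
      Fintype.card K + 1 := by
  refine (Finset.card_insert_le _ _).trans ?_
  have h := (Finset.card_image_le (s := (Finset.univ : Finset K))
    (f := fun t : K => (![t, 1] : Fin 2 → K)))
  rw [Finset.card_univ] at h
  omega

variable {K}

/-- Every non-zero vector of `K²` is a non-zero scalar multiple of a line representative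
`(1,0)` or `(t,1)`. [folklore] -/
theorem frameStructure_exists_smul_eq {u : Fin 2 → K} (hu : u ≠ 0) :
    ∃ r ∈ insert (![1, 0] : Fin 2 → K) (Finset.univ.image fun t : K => ![t, 1]),
      ∃ t : K, t ≠ 0 ∧ t • r = u := by
  by_cases h1 : u 1 = 0
  · have h0 : u 0 ≠ 0 := by
      intro h0
      apply hu
      funext i
      fin_cases i
      · exact h0
      · exact h1
    refine ⟨![1, 0], Finset.mem_insert_self _ _, u 0, h0, ?_⟩
    funext i
    fin_cases i
    · simp
    · simp [h1]
  · refine ⟨![u 0 / u 1, 1], Finset.mem_insert_of_mem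
        (Finset.mem_image_of_mem _ (Finset.mem_univ (u 0 / u 1))), u 1, h1, ?_⟩
    funext i
    fin_cases i
    · simp only [Pi.smul_apply, smul_eq_mul]
      simp only [Fin.zero_eta, Matrix.cons_val_zero]
      field_simp
    · simp

omit [Fintype K] [DecidableEq K] in
/-- Scalar matrices act on vectors by scalars. [folklore] -/
theorem frameStructure_scalar_smul_eq (t : Kˣ) (r : Fin 2 → K) :
    (Matrix.GeneralLinearGroup.scalar (Fin 2) t) • r = (t : K) • r := by
  rw [Units.smul_def, Matrix.GeneralLinearGroup.coe_scalar, Matrix.smul_eq_mulVec,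
    Matrix.scalar_apply]
  funext i
  rw [Matrix.mulVec_diagonal, Pi.smul_apply, smul_eq_mul]

omit [Fintype K] [DecidableEq K] in
/-- Scalar matrices are central in `GL₂(K)`. [folklore] -/
theorem frameStructure_scalar_mem_center (t : Kˣ) :
    Matrix.GeneralLinearGroup.scalar (Fin 2) t ∈
      Submonoid.center (Matrix.GeneralLinearGroup (Fin 2) K) :=
  Submonoid.mem_center_iff.2 fun g => (Matrix.GeneralLinearGroup.scalar_commute t g).symm

/-- **Orbit cover in `K²`**: for a point `a ∈ K²`, either `a = 0` (orbit `{0}`, covered by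
`R = {0}`) or `a ≠ 0` (orbit `K² ∖ {0}`, covered by the `≤ |K| + 1` line representatives moved by
central scalars); in both cases a cover of size `≤ |K| + 1` in the sense of
`LevelOneLink.finrank_le_card_of_cover`. [folklore] -/
theorem frameStructure_exists_cover (a : Fin 2 → K) :
    ∃ R : Finset (Fin 2 → K), R.card ≤ Fintype.card K + 1 ∧
      ∀ u : Fin 2 → K, (∀ g : Matrix.GeneralLinearGroup (Fin 2) K, g • a ≠ u) ∨
        ∃ r ∈ R, ∃ z : Matrix.GeneralLinearGroup (Fin 2) K,
          z ∈ Submonoid.center (Matrix.GeneralLinearGroup (Fin 2) K) ∧ z • r = u := by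
  by_cases ha : a = 0
  · refine ⟨{0}, by rw [Finset.card_singleton]; omega, fun u => ?_⟩
    by_cases hu : u = 0
    · exact Or.inr ⟨0, Finset.mem_singleton_self _, 1, Submonoid.one_mem _, by rw [one_smul, hu]⟩
    · refine Or.inl fun g hg => hu ?_
      rw [← hg, ha, Units.smul_def, Matrix.smul_eq_mulVec, Matrix.mulVec_zero]
  · refine ⟨_, frameStructure_card_reps_le K, fun u => ?_⟩
    by_cases hu : u = 0
    · refine Or.inl fun g hg => ha ?_
      rw [hu, smul_eq_iff_eq_inv_smul] at hg
      rw [hg, Units.smul_def, Matrix.smul_eq_mulVec, Matrix.mulVec_zero]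
    · obtain ⟨r, hr, t, ht, rfl⟩ := frameStructure_exists_smul_eq hu
      exact Or.inr ⟨r, hr, Matrix.GeneralLinearGroup.scalar (Fin 2) (Units.mk0 t ht),
        frameStructure_scalar_mem_center _,
        by rw [frameStructure_scalar_smul_eq, Units.val_mk0]⟩

/-! ### (ii) Degree bound for irreducible frame characters -/

/-- **Degree of a level-one irreducible character of `GL₂(K)`.** If an irreducible character `χ`
of `GL₂(K)` is a frame function `χ(g) = ∑_u c u (g·u)`, then `χ(1) ≤ |K| + 1`: `χ` is a sum of
functions of single orbit points of `GL₂(K)` on `K²`, so its representation has a `Stab(a)`-fixed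
vector (`exists_fixed_of_character_eq_sum`) and is spanned by the images of a central-scalar
cover of the orbit of `a` (`finrank_le_card_of_cover`, `frameStructure_exists_cover`).
[folklore] -/
theorem frameStructure_degree_le {χ : Matrix.GeneralLinearGroup (Fin 2) K → ℂ}
    (hχ : χ ∈ irrChars (Matrix.GeneralLinearGroup (Fin 2) K))
    (hF : ∃ c : (Fin 2 → K) → (Fin 2 → K) → ℂ, ∀ g : Matrix.GeneralLinearGroup (Fin 2) K,
      χ g = ∑ u : Fin 2 → K, c u ((g : Matrix (Fin 2) (Fin 2) K).mulVec u)) :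
    (χ 1).re ≤ (Fintype.card K : ℝ) + 1 := by
  obtain ⟨V, _, _, _, ρ, hρ, rfl⟩ := hχ
  obtain ⟨c, hc⟩ := hF
  haveI := hρ
  have hsum : ∀ g : Matrix.GeneralLinearGroup (Fin 2) K, ρ.character g =
      ∑ u : Fin 2 → K, c u (g • id u) := fun g => hc g
  obtain ⟨a, w, hw0, hw⟩ := exists_fixed_of_character_eq_sum ρ id c hsum
  obtain ⟨R, hR, hcover⟩ := frameStructure_exists_cover (K := K) a
  have h := (finrank_le_card_of_cover ρ (id a) hw0 hw R hcover).trans hR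
  rw [ρ.char_one, Complex.natCast_re]
  exact_mod_cast h

/-! ### (i) A spanning set of size `≤ |K|³ + |K|²`

We work with an arbitrary submodule `S` containing the indicators `g ↦ [g·r = v]` at the line
representatives, and specialise to their span at the end. -/

/-- The constant function `1 = ∑_{v} [g·r₀ = v]` lies in any submodule containing the indicators
`[g·r₀ = v]`, `v ∈ K²`. -/
theorem frameStructure_one_mem {S : Submodule ℂ (Matrix.GeneralLinearGroup (Fin 2) K → ℂ)}
    {r₀ : Fin 2 → K} (hS : ∀ v : Fin 2 → K, (fun g : Matrix.GeneralLinearGroup (Fin 2) K =>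
      if (g : Matrix (Fin 2) (Fin 2) K).mulVec r₀ = v then (1 : ℂ) else 0) ∈ S) :
    (fun _ : Matrix.GeneralLinearGroup (Fin 2) K => (1 : ℂ)) ∈ S := by
  have h : (fun _ : Matrix.GeneralLinearGroup (Fin 2) K => (1 : ℂ)) =
      ∑ v : Fin 2 → K, fun g : Matrix.GeneralLinearGroup (Fin 2) K =>
        if (g : Matrix (Fin 2) (Fin 2) K).mulVec r₀ = v then (1 : ℂ) else 0 := by
    funext g
    rw [Finset.sum_apply, Finset.sum_ite_eq, if_pos (Finset.mem_univ _)]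
  rw [h]
  exact Submodule.sum_mem _ fun v _ => hS v

/-- Every indicator `[g·u = v]` lies in a submodule `S` containing the indicators at a non-empty
set `Reps` of line representatives: for `u = 0` it is `0` or the constant `1`; for `u = t • r`
(`r ∈ Reps`, `t ≠ 0`) it is `[g·r = t⁻¹ • v]`. -/
theorem frameStructure_ind_mem {S : Submodule ℂ (Matrix.GeneralLinearGroup (Fin 2) K → ℂ)}
    {Reps : Finset (Fin 2 → K)} (hne : Reps.Nonempty)
    (hcov : ∀ u : Fin 2 → K, u ≠ 0 → ∃ r ∈ Reps, ∃ t : K, t ≠ 0 ∧ t • r = u)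
    (hS : ∀ r ∈ Reps, ∀ v : Fin 2 → K, (fun g : Matrix.GeneralLinearGroup (Fin 2) K =>
      if (g : Matrix (Fin 2) (Fin 2) K).mulVec r = v then (1 : ℂ) else 0) ∈ S)
    (u v : Fin 2 → K) :
    (fun g : Matrix.GeneralLinearGroup (Fin 2) K =>
      if (g : Matrix (Fin 2) (Fin 2) K).mulVec u = v then (1 : ℂ) else 0) ∈ S := by
  by_cases hu : u = 0
  · subst hu
    by_cases hv : v = 0
    · subst hv
      have h : (fun g : Matrix.GeneralLinearGroup (Fin 2) K =>
          if (g : Matrix (Fin 2) (Fin 2) K).mulVec (0 : Fin 2 → K) = 0 then (1 : ℂ) else 0) =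
          fun _ : Matrix.GeneralLinearGroup (Fin 2) K => (1 : ℂ) := by
        funext g
        rw [Matrix.mulVec_zero, if_pos rfl]
      rw [h]
      obtain ⟨r₀, hr₀⟩ := hne
      exact frameStructure_one_mem (hS r₀ hr₀)
    · have h : (fun g : Matrix.GeneralLinearGroup (Fin 2) K =>
          if (g : Matrix (Fin 2) (Fin 2) K).mulVec (0 : Fin 2 → K) = v then (1 : ℂ) else 0) =
          0 := by
        funext g
        rw [Matrix.mulVec_zero, if_neg (Ne.symm hv), Pi.zero_apply]
      rw [h]
      exact Submodule.zero_mem _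
  · obtain ⟨r, hr, t, ht, rfl⟩ := hcov u hu
    have h : (fun g : Matrix.GeneralLinearGroup (Fin 2) K =>
        if (g : Matrix (Fin 2) (Fin 2) K).mulVec (t • r) = v then (1 : ℂ) else 0) =
        fun g : Matrix.GeneralLinearGroup (Fin 2) K =>
          if (g : Matrix (Fin 2) (Fin 2) K).mulVec r = t⁻¹ • v then (1 : ℂ) else 0 := by
      funext g
      rw [Matrix.mulVec_smul]
      exact if_congr (eq_inv_smul_iff₀ ht).symm rfl rfl
    rw [h]
    exact hS r hr _

/-- **Frame functions as combinations of indicators**: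
`∑_u c u (g·u) = ∑_u ∑_v c u v • [g·u = v]`. -/
theorem frameStructure_frameFn_eq (c : (Fin 2 → K) → (Fin 2 → K) → ℂ) :
    (fun g : Matrix.GeneralLinearGroup (Fin 2) K =>
        ∑ u : Fin 2 → K, c u ((g : Matrix (Fin 2) (Fin 2) K).mulVec u)) =
      ∑ u : Fin 2 → K, ∑ v : Fin 2 → K, c u v • fun g : Matrix.GeneralLinearGroup (Fin 2) K =>
        if (g : Matrix (Fin 2) (Fin 2) K).mulVec u = v then (1 : ℂ) else 0 := by
  funext g
  rw [Finset.sum_apply]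
  refine Finset.sum_congr rfl fun u _ => ?_
  rw [Finset.sum_apply]
  simp only [Pi.smul_apply, smul_eq_mul, mul_ite, mul_one, mul_zero]
  rw [Finset.sum_ite_eq, if_pos (Finset.mem_univ _)]

/-- **(i)** Every frame function lies in a submodule `S` containing the indicators at a
non-empty set of line representatives covering `K² ∖ {0}` by scalars. -/
theorem frameStructure_frameFn_mem {S : Submodule ℂ (Matrix.GeneralLinearGroup (Fin 2) K → ℂ)}
    {Reps : Finset (Fin 2 → K)} (hne : Reps.Nonempty)
    (hcov : ∀ u : Fin 2 → K, u ≠ 0 → ∃ r ∈ Reps, ∃ t : K, t ≠ 0 ∧ t • r = u)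
    (hS : ∀ r ∈ Reps, ∀ v : Fin 2 → K, (fun g : Matrix.GeneralLinearGroup (Fin 2) K =>
      if (g : Matrix (Fin 2) (Fin 2) K).mulVec r = v then (1 : ℂ) else 0) ∈ S)
    (c : (Fin 2 → K) → (Fin 2 → K) → ℂ) :
    (fun g : Matrix.GeneralLinearGroup (Fin 2) K =>
        ∑ u : Fin 2 → K, c u ((g : Matrix (Fin 2) (Fin 2) K).mulVec u)) ∈ S := by
  rw [frameStructure_frameFn_eq]
  exact Submodule.sum_mem _ fun u _ => Submodule.sum_mem _ fun v _ =>
    Submodule.smul_mem _ _ (frameStructure_ind_mem hne hcov hS u v)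

variable (K)

/-- **(i), assembled**: the `≤ |K|³ + |K|²` indicators `[g·r = v]` (`r` a line representative
`(1,0)` or `(t,1)`, `v ∈ K²`) span all frame functions. [folklore] -/
theorem frameStructure_exists_spanning :
    ∃ B : Finset (Matrix.GeneralLinearGroup (Fin 2) K → ℂ),
      B.card ≤ Fintype.card K ^ 3 + Fintype.card K ^ 2 ∧
      ∀ c : (Fin 2 → K) → (Fin 2 → K) → ℂ,
        (fun g : Matrix.GeneralLinearGroup (Fin 2) K =>
            ∑ u : Fin 2 → K, c u ((g : Matrix (Fin 2) (Fin 2) K).mulVec u)) ∈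
          Submodule.span ℂ (B : Set (Matrix.GeneralLinearGroup (Fin 2) K → ℂ)) := by
  set Reps : Finset (Fin 2 → K) :=
    insert (![1, 0] : Fin 2 → K) (Finset.univ.image fun t : K => ![t, 1]) with hReps
  refine ⟨(Reps ×ˢ (Finset.univ : Finset (Fin 2 → K))).image
    fun rv => fun g : Matrix.GeneralLinearGroup (Fin 2) K =>
      if (g : Matrix (Fin 2) (Fin 2) K).mulVec rv.1 = rv.2 then (1 : ℂ) else 0, ?_, fun c => ?_⟩
  · refine Finset.card_image_le.trans ?_
    rw [Finset.card_product, Finset.card_univ, Fintype.card_fun, Fintype.card_fin]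
    calc Reps.card * Fintype.card K ^ 2
        ≤ (Fintype.card K + 1) * Fintype.card K ^ 2 :=
          Nat.mul_le_mul_right _ (frameStructure_card_reps_le K)
      _ = Fintype.card K ^ 3 + Fintype.card K ^ 2 := by ring
  · refine frameStructure_frameFn_mem (Finset.insert_nonempty _ _)
      (fun u hu => frameStructure_exists_smul_eq hu) (fun r hr v => ?_) c
    exact Submodule.subset_span (Finset.mem_coe.2 (Finset.mem_image_of_mem _
      (Finset.mk_mem_product hr (Finset.mem_univ v))))

end GL2

/-- **S2 `FrameStructure`** (registered stub `stub_frameStructure` of line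
`quadratic-extension-level-one-cell`, crux `LevelGradedCohnUmans.GradedDesignFamily`). For every
finite field `K` (`Q = |K|`): (i) the frame functions `g ↦ ∑_u c u (g·u)` on `GL₂(K)` are spanned
by `≤ Q³ + Q²` functions (the indicators `[g·r = v]`, `r` one of `≤ Q + 1` line representatives,
`v ∈ K²`); (ii) every irreducible character of `GL₂(K)` which is a frame function has degree
`≤ Q + 1` (a stabiliser-fixed vector and a central-scalar line cover, via the permutation-module
lemmas of `LevelGradedCohnUmansLevelOneLinkPermModule`). [folklore] -/
theorem stub_frameStructure :
    ∀ (K : Type) [Field K] [Fintype K] [DecidableEq K],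
      (∃ B : Finset (Matrix.GeneralLinearGroup (Fin 2) K → ℂ),
          B.card ≤ Fintype.card K ^ 3 + Fintype.card K ^ 2 ∧
          ∀ c : (Fin 2 → K) → (Fin 2 → K) → ℂ,
            (fun g : Matrix.GeneralLinearGroup (Fin 2) K =>
                ∑ u : Fin 2 → K, c u ((g : Matrix (Fin 2) (Fin 2) K).mulVec u)) ∈
              Submodule.span ℂ (B : Set (Matrix.GeneralLinearGroup (Fin 2) K → ℂ))) ∧
      ∀ χ ∈ Literature.RepresentationTheory.FiniteGroups.irrChars (Matrix.GeneralLinearGroup (Fin 2) K),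
        (∃ c : (Fin 2 → K) → (Fin 2 → K) → ℂ, ∀ g : Matrix.GeneralLinearGroup (Fin 2) K,
            χ g = ∑ u : Fin 2 → K, c u ((g : Matrix (Fin 2) (Fin 2) K).mulVec u)) →
          (χ 1).re ≤ (Fintype.card K : ℝ) + 1 := by
  intro K _ _ _
  exact ⟨frameStructure_exists_spanning K, fun χ hχ hF => frameStructure_degree_le hχ hF⟩

end Summit.MatrixMultiplication.MatrixMultiplication.Theorems.GradedDesignFamily

end
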